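import Literature.Combinatorics.SimpleGraph.SeparatorOracle
import HarnessLib

/-!
# Treewidth approximation by iterative compression (flow-free Robertson–Seymour, list form)

Topic `Literature/Combinatorics/SimpleGraph`, the last piece of the treewidth-approximation chain
`ListTreeDecomposition` → `ListTreeDecompositionSeparators` → `TreewidthApproximation` (the
Robertson–Seymour procedure over a separator oracle) → `SeparatorOracle` (the oracle as a min-plus
dynamic programme over an AUXILIARY decomposition). The auxiliary decomposition is obtained by
**iterative compression** (Reed, Smith and Vetta's device; for treewidth: Bodlaender's linear-time
algorithm, §1, and Korhonen, FOCS 2021): insert the vertices `0, 1, …, nv-1` one at a time; a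
decomposition of width `≤ 4k + 4` of the graph on the first `i` vertices becomes, by adding the new
vertex to every bag, a decomposition of width `≤ 4k + 5` of the graph on the first `i + 1`
vertices, over which the separator oracle runs, and the Robertson–Seymour procedure compresses it
back to width `≤ 4k + 4`. No maximum flow is ever computed.

* `edgesUpTo`, `addVertex`, `compressStep`, **`approxTD k cap nv edges`** (the whole algorithm:
  `Option (parents, bags)`);
* `isRootedTD_addVertex`, `valid_helper` (the auxiliary context is valid);
* **`approxTD_spec`**: if the graph (vertices `< nv`, edge list `edges`) has SOME rooted tree
  decomposition in list form with bags of size `≤ k + 1` covering the edges, and `cap ≥ 3^{4k+6}`,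
  then `approxTD` returns a rooted tree decomposition of the vertices `< nv` covering the edges,
  with all bags of size `≤ 4k + 5` (Cygan et al., Thm. 7.18: width `≤ 4k + 4`);
  `approxTD_sound`: whatever it returns is such a decomposition (no promise needed).

## References

* M. Cygan et al., *Parameterized Algorithms*, Springer 2015, Thm. 7.18; §4 (iterative
  compression).
* B. Reed, K. Smith, A. Vetta, *Finding odd cycle transversals*, Oper. Res. Lett. 32 (2004)
  (iterative compression); T. Korhonen, FOCS 2021, §1.
* H. L. Bodlaender, *A linear-time algorithm for finding tree-decompositions of small treewidth*,
  SIAM J. Comput. 25 (1996), §1 (using a decomposition of a reduced graph to decompose the graph).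
-/

namespace Literature.Combinatorics.SimpleGraph

namespace ListTD

open Finset

/-! ### The algorithm -/

/-- The edges among the first `n` vertices. [folklore] -/
def edgesUpTo (edges : List (ℕ × ℕ)) (n : ℕ) : List (ℕ × ℕ) :=
  edges.filter fun e => decide (e.1 < n ∧ e.2 < n)

/-- **Adding a vertex to every bag.** [cite: CyganEtAl2015, §4 (iterative compression)] -/
def addVertex (bags : List (List ℕ)) (v : ℕ) : List (List ℕ) := bags.map fun B => B ++ [v]

/-- **One compression round**: from a decomposition of the first `i` vertices, the auxiliary
context on the first `i + 1` vertices and the Robertson–Seymour run over its separator oracle.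
[cite: CyganEtAl2015, Thm 7.18 and §4] -/
noncomputable def compressStep (k cap : ℕ) (edges : List (ℕ × ℕ)) (st : Option (List ℕ × List (List ℕ))) (i : ℕ) :
    Option (List ℕ × List (List ℕ)) :=
  match st with
  | none => none
  | some D => rsResult (sepOracle ⟨i + 1, cap, edgesUpTo edges (i + 1), D.1, addVertex D.2 i⟩ k) k
      (List.range (i + 1)) (2 * (i + 1) + 1)

/-- **The treewidth approximation**: insert the vertices one at a time, compressing after each.
[cite: CyganEtAl2015, Thm 7.18 and §4] -/
noncomputable def approxTD (k cap nv : ℕ) (edges : List (ℕ × ℕ)) : Option (List ℕ × List (List ℕ)) :=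
  (List.range nv).foldl (compressStep k cap edges) (some ([0], [[]]))

/-! ### The auxiliary context is valid -/

/-- Bags with a vertex added. [folklore] -/
theorem bagOf_addVertex (bags : List (List ℕ)) (v t : ℕ) :
    bagOf (addVertex bags v) t = if t < bags.length then bagOf bags t ++ [v] else [] := by
  unfold addVertex
  split_ifs with ht
  · rw [bagOf_eq_getElem (by simpa using ht), bagOf_eq_getElem ht, List.getElem_map]
  · rw [bagOf_eq_nil (by simpa using not_lt.1 ht)]

/-- **Adding the new vertex `i` to every bag of a rooted decomposition of the vertices `< i` gives
a rooted decomposition of the vertices `< i + 1`.** [cite: CyganEtAl2015, §4 (iterative compression)] -/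
theorem isRootedTD_addVertex {i : ℕ} {par : List ℕ} {bags : List (List ℕ)} (hD : IsRootedTD i par bags) :
    IsRootedTD (i + 1) par (addVertex bags i) := by
  have hlen : (addVertex bags i).length = bags.length := by simp [addVertex]
  refine ⟨by rw [hlen]; exact hD.length_par, by rw [hlen]; exact hD.pos, fun t h0 ht => hD.par_lt t h0 (hlen ▸ ht),
    fun t v hv => ?_, fun t => ?_, fun v hv => ?_, fun v s t hst ht hvt hvs => ?_⟩
  · rw [bagOf_addVertex] at hv
    split_ifs at hv with ht
    · rcases List.mem_append.1 hv with hv | hv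
      · have := Finset.mem_range.1 (hD.bag_mem t v hv); exact Finset.mem_range.2 (by omega)
      · simp only [List.mem_singleton] at hv; exact Finset.mem_range.2 (by omega)
    · simp at hv
  · rw [bagOf_addVertex]
    split_ifs with ht
    · refine List.Nodup.append (hD.bag_nodup t) (List.nodup_singleton i) fun v hv hv' => ?_
      simp only [List.mem_singleton] at hv'
      have := Finset.mem_range.1 (hD.bag_mem t v hv); omega
    · exact List.nodup_nil
  · have hv' := Finset.mem_range.1 hv
    rcases Nat.lt_or_ge v i with hlt | hge
    · obtain ⟨t, ht, hvt⟩ := hD.cover v (Finset.mem_range.2 hlt)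
      exact ⟨t, hlen ▸ ht, by rw [bagOf_addVertex, if_pos ht]; exact List.mem_append_left _ hvt⟩
    · have hvi : v = i := by omega
      subst hvi
      exact ⟨0, hlen ▸ hD.pos, by rw [bagOf_addVertex, if_pos hD.pos]; simp⟩
  · rw [hlen] at ht
    rw [bagOf_addVertex, if_pos ht] at hvt
    rw [bagOf_addVertex, if_pos (hst.trans ht)] at hvs
    have hpt : parOf par t < bags.length := (hD.par_lt t (by omega) ht).trans ht
    rw [bagOf_addVertex, if_pos hpt]
    rcases List.mem_append.1 hvt with hvt | hvt
    · rcases List.mem_append.1 hvs with hvs | hvs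
      · exact List.mem_append_left _ (hD.rooted v s t hst ht hvt hvs)
      · simp only [List.mem_singleton] at hvs
        have := Finset.mem_range.1 (hD.bag_mem t v hvt); omega
    · exact List.mem_append_right _ hvt

/-- **The auxiliary context of a round is valid**, given a decomposition of the first `i` vertices
covering the edges among them with bags of size `≤ 4k + 5`, and a budget `≥ 3^{4k+6}`.
[cite: CyganEtAl2015, §4] -/
theorem valid_helper {k cap i : ℕ} {edges : List (ℕ × ℕ)} {par : List ℕ} {bags : List (List ℕ)}
    (hD : IsRootedTD i par bags)
    (hE : ∀ e ∈ edgesUpTo edges i, ∃ t, t < bags.length ∧ e.1 ∈ bagOf bags t ∧ e.2 ∈ bagOf bags t)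
    (hw : ∀ t, (bagOf bags t).length ≤ 4 * k + 5) (hcap : 3 ^ (4 * k + 6) ≤ cap) :
    SepCtx.Valid ⟨i + 1, cap, edgesUpTo edges (i + 1), par, addVertex bags i⟩ := by
  have hlen : (addVertex bags i).length = bags.length := by simp [addVertex]
  refine ⟨isRootedTD_addVertex hD, fun e he => ?_, fun t ht => ?_⟩
  · simp only [edgesUpTo, List.mem_filter, decide_eq_true_eq] at he
    obtain ⟨he, h1, h2⟩ := he
    refine ⟨h1, h2, ?_⟩
    simp only [hlen]
    -- both ends old: an old bag; otherwise a bag containing the old end (or any bag), plus `i`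
    have hcov : ∀ v, v < i → ∃ t, t < bags.length ∧ v ∈ bagOf (addVertex bags i) t ∧ i ∈ bagOf (addVertex bags i) t := by
      intro v hv
      obtain ⟨t, ht, hvt⟩ := hD.cover v (Finset.mem_range.2 hv)
      exact ⟨t, ht, by rw [bagOf_addVertex, if_pos ht]; simp [hvt], by rw [bagOf_addVertex, if_pos ht]; simp⟩
    rcases Nat.lt_or_ge e.1 i with h1' | h1'
    · rcases Nat.lt_or_ge e.2 i with h2' | h2'
      · obtain ⟨t, ht, ha, hb⟩ := hE e (by simp [edgesUpTo, he, h1', h2'])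
        exact ⟨t, ht, by rw [bagOf_addVertex, if_pos ht]; exact List.mem_append_left _ ha,
          by rw [bagOf_addVertex, if_pos ht]; exact List.mem_append_left _ hb⟩
      · have he2 : e.2 = i := by omega
        obtain ⟨t, ht, ha, hb⟩ := hcov e.1 h1'
        exact ⟨t, ht, ha, he2 ▸ hb⟩
    · have he1 : e.1 = i := by omega
      rcases Nat.lt_or_ge e.2 i with h2' | h2'
      · obtain ⟨t, ht, ha, hb⟩ := hcov e.2 h2'
        exact ⟨t, ht, he1 ▸ hb, ha⟩
      · have he2 : e.2 = i := by omega
        refine ⟨0, hD.pos, ?_, ?_⟩ <;> rw [bagOf_addVertex, if_pos hD.pos] <;> simp [he1, he2]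
  · simp only at ht ⊢
    rw [bagOf_addVertex]
    split_ifs with ht'
    · calc 3 ^ (bagOf bags t ++ [i]).length ≤ 3 ^ (4 * k + 6) :=
          Nat.pow_le_pow_right (by norm_num) (by simp; have := hw t; omega)
        _ ≤ cap := hcap
    · exact le_trans (by simp) (le_trans (Nat.one_le_pow _ _ (by norm_num)) hcap)

/-! ### The invariant and the theorems -/

/-- **A good decomposition of the first `i` vertices**: rooted, covering the edges among them, bags
of size `≤ 4k + 5`. [folklore] -/
def Good (k : ℕ) (edges : List (ℕ × ℕ)) (i : ℕ) (D : List ℕ × List (List ℕ)) : Prop :=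
  IsRootedTD i D.1 D.2 ∧ (∀ e ∈ edgesUpTo edges i, ∃ t, t < D.2.length ∧ e.1 ∈ bagOf D.2 t ∧ e.2 ∈ bagOf D.2 t) ∧
    ∀ t, (bagOf D.2 t).length ≤ 4 * k + 5

/-- The trivial decomposition of no vertices is good. [folklore] -/
theorem good_zero (k : ℕ) (edges : List (ℕ × ℕ)) : Good k edges 0 ([0], [[]]) := by
  refine ⟨⟨rfl, by simp, fun t h0 ht => by simp at ht; omega, fun t v hv => ?_, fun t => ?_, fun v hv => by simp at hv,
    fun v s t hst ht => by simp at ht; omega⟩, fun e he => ?_, fun t => ?_⟩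
  · rcases Nat.eq_zero_or_pos t with rfl | ht
    · simp [bagOf] at hv
    · rw [bagOf_eq_nil (by simp; omega)] at hv; simp at hv
  · rcases Nat.eq_zero_or_pos t with rfl | ht
    · simp [bagOf]
    · rw [bagOf_eq_nil (by simp; omega)]; exact List.nodup_nil
  · simp [edgesUpTo] at he
  · rcases Nat.eq_zero_or_pos t with rfl | ht
    · simp [bagOf]
    · rw [bagOf_eq_nil (by simp; omega)]; exact Nat.zero_le _

/-- `List.range` as a finset. [folklore] -/
theorem toFinset_range (n : ℕ) : (List.range n).toFinset = Finset.range n := by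
  ext v; simp

/-- **A successful round yields a good decomposition of one more vertex** (validity of the
Robertson–Seymour run over the sound separator oracle). [cite: CyganEtAl2015, Thm 7.18] -/
theorem good_of_compressStep {k cap i : ℕ} {edges : List (ℕ × ℕ)} {D D' : List ℕ × List (List ℕ)}
    (hD : Good k edges i D) (hcap : 3 ^ (4 * k + 6) ≤ cap) (h : compressStep k cap edges (some D) i = some D') :
    Good k edges (i + 1) D' := by
  obtain ⟨hD1, hD2, hD3⟩ := hD
  have hV := valid_helper hD1 hD2 hD3 hcap
  unfold compressStep at h
  simp only at h
  obtain ⟨par', bags'⟩ := D'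
  obtain ⟨hTD, hCE, hw⟩ := isRootedTDOn_rsResult (edgeRel_symm _) (sepOracle_sound hV k) (List.nodup_range) h
  rw [toFinset_range] at hTD hCE
  refine ⟨hTD, fun e he => ?_, hw⟩
  have he' := he
  simp only [edgesUpTo, List.mem_filter, decide_eq_true_eq] at he'
  exact hCE e.1 (Finset.mem_range.2 he'.2.1) e.2 (Finset.mem_range.2 he'.2.2) (Or.inl he)

/-- **A round succeeds** when the whole graph has a small rooted decomposition (completeness of the
run over the sound and complete oracle). [cite: CyganEtAl2015, Thm 7.18] -/
theorem compressStep_isSome {k cap nv i : ℕ} {edges : List (ℕ × ℕ)} {D : List ℕ × List (List ℕ)}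
    (hD : Good k edges i D) (hcap : 3 ^ (4 * k + 6) ≤ cap) (hi : i < nv)
    (hex : ∃ par bags, IsRootedTD nv par bags ∧
      (∀ e ∈ edges, ∃ t, t < bags.length ∧ e.1 ∈ bagOf bags t ∧ e.2 ∈ bagOf bags t) ∧
      ∀ t, t < bags.length → (bagOf bags t).length ≤ k + 1) :
    (compressStep k cap edges (some D) i).isSome = true := by
  obtain ⟨hD1, hD2, hD3⟩ := hD
  have hV := valid_helper hD1 hD2 hD3 hcap
  unfold compressStep
  simp only
  refine rsResult_isSome (edgeRel_symm _) (sepOracle_sound hV k) (sepOracle_complete hV k) List.nodup_range ?_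
    (by simp)
  -- restrict the small decomposition of the whole graph to the first `i + 1` vertices
  obtain ⟨par, bags, hTD, hE, hk⟩ := hex
  have hsub : (List.range (i + 1)).toFinset ⊆ Finset.range nv := by
    rw [toFinset_range]; exact Finset.range_subset_range.2 (by omega)
  refine ⟨par, bags.map fun B => B.filter fun v => decide (v ∈ (List.range (i + 1)).toFinset), hTD.induce hsub,
    fun u hu v hv huv => ?_, fun t ht => ?_⟩
  · -- an edge among the first `i + 1` vertices lies in a bag of the whole decomposition
    have key : ∀ a b, (a, b) ∈ edgesUpTo edges (i + 1) → a ∈ (List.range (i + 1)).toFinset → b ∈ (List.range (i + 1)).toFinset →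
        ∃ t, t < (bags.map fun B => B.filter fun v => decide (v ∈ (List.range (i + 1)).toFinset)).length ∧
          a ∈ bagOf (bags.map fun B => B.filter fun v => decide (v ∈ (List.range (i + 1)).toFinset)) t ∧
          b ∈ bagOf (bags.map fun B => B.filter fun v => decide (v ∈ (List.range (i + 1)).toFinset)) t := by
      intro a b hab ha hb
      simp only [edgesUpTo, List.mem_filter, decide_eq_true_eq] at hab
      obtain ⟨t, ht, hat, hbt⟩ := hE _ hab.1
      refine ⟨t, by simpa using ht, ?_, ?_⟩ <;> rw [bagOf_map_filter] <;> simp only [List.mem_filter] <;>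
        simp [hat, hbt, ha, hb]
    rcases huv with h | h
    · exact key u v h hu hv
    · obtain ⟨t, ht, h1, h2⟩ := key v u h hv hu
      exact ⟨t, ht, h2, h1⟩
  · rw [bagOf_map_filter]
    exact (List.length_filter_le _ _).trans (hk t (by simpa using ht))

/-- **The invariant of the insertion loop.** [folklore] -/
theorem approxTD_foldl {k cap nv : ℕ} {edges : List (ℕ × ℕ)} (hcap : 3 ^ (4 * k + 6) ≤ cap)
    (hex : ∃ par bags, IsRootedTD nv par bags ∧
      (∀ e ∈ edges, ∃ t, t < bags.length ∧ e.1 ∈ bagOf bags t ∧ e.2 ∈ bagOf bags t) ∧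
      ∀ t, t < bags.length → (bagOf bags t).length ≤ k + 1) :
    ∀ n, n ≤ nv → ∃ D, (List.range n).foldl (compressStep k cap edges) (some ([0], [[]])) = some D ∧ Good k edges n D
  | 0, _ => ⟨_, rfl, good_zero k edges⟩
  | n + 1, hn => by
    obtain ⟨D, hfold, hgood⟩ := approxTD_foldl hcap hex n (by omega)
    rw [List.range_succ, List.foldl_append, List.foldl_cons, List.foldl_nil, hfold]
    have hsome := compressStep_isSome hgood hcap (by omega) hex
    obtain ⟨D', hD'⟩ := Option.isSome_iff_exists.1 hsome
    exact ⟨D', hD', good_of_compressStep hgood hcap hD'⟩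

/-- **Treewidth approximation without flows** (Cygan et al., Thm. 7.18, realised by iterative
compression and a min-plus dynamic programme): if the graph on the vertices `< nv` with edge list
`edges` has a rooted tree decomposition (list form) with bags of size `≤ k + 1` covering the edges,
and `cap ≥ 3^{4k+6}`, then `approxTD` returns a rooted tree decomposition of the vertices `< nv`
covering the edges with bags of size `≤ 4k + 5`. [cite: CyganEtAl2015, Thm 7.18] -/
theorem approxTD_spec {k cap nv : ℕ} {edges : List (ℕ × ℕ)} (hcap : 3 ^ (4 * k + 6) ≤ cap)
    (hex : ∃ par bags, IsRootedTD nv par bags ∧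
      (∀ e ∈ edges, ∃ t, t < bags.length ∧ e.1 ∈ bagOf bags t ∧ e.2 ∈ bagOf bags t) ∧
      ∀ t, t < bags.length → (bagOf bags t).length ≤ k + 1)
    (hedges : ∀ e ∈ edges, e.1 < nv ∧ e.2 < nv) :
    ∃ par bags, approxTD k cap nv edges = some (par, bags) ∧ IsRootedTD nv par bags ∧
      (∀ e ∈ edges, ∃ t, t < bags.length ∧ e.1 ∈ bagOf bags t ∧ e.2 ∈ bagOf bags t) ∧
      ∀ t, (bagOf bags t).length ≤ 4 * k + 5 := by
  obtain ⟨⟨par, bags⟩, hfold, h1, h2, h3⟩ := approxTD_foldl hcap hex nv le_rfl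
  refine ⟨par, bags, hfold, h1, fun e he => h2 e ?_, h3⟩
  simpa [edgesUpTo] using And.intro he (hedges e he)

/-- **Soundness without the promise**: whatever `approxTD` returns is a rooted tree decomposition of
the vertices `< nv` covering the edges among them, with bags of size `≤ 4k + 5`. [cite: CyganEtAl2015, Thm 7.18] -/
theorem approxTD_sound {k cap nv : ℕ} {edges : List (ℕ × ℕ)} (hcap : 3 ^ (4 * k + 6) ≤ cap)
    {D : List ℕ × List (List ℕ)} (h : approxTD k cap nv edges = some D) : Good k edges nv D := by
  -- `none` is absorbing, so every intermediate round returned `some`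
  suffices H : ∀ n D, (List.range n).foldl (compressStep k cap edges) (some ([0], [[]])) = some D → Good k edges n D from
    H nv D h
  intro n
  induction n with
  | zero => intro D hD; simp at hD; rw [← hD]; exact good_zero k edges
  | succ n ih =>
    intro D hD
    rw [List.range_succ, List.foldl_append, List.foldl_cons, List.foldl_nil] at hD
    rcases hprev : (List.range n).foldl (compressStep k cap edges) (some ([0], [[]])) with _ | D₀
    · rw [hprev] at hD; simp [compressStep] at hD
    · rw [hprev] at hD
      exact good_of_compressStep (ih D₀ hprev) hcap hD

end ListTD

end Literature.Combinatorics.SimpleGraph
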